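import Summits.QuantumFields.YangMills.Theses.LuscherReduction
import Summits.QuantumFields.YangMills.Theorems.LuscherReductionTraceDoorDefs
import Summits.QuantumFields.YangMills.Theorems.FemtoTransferGapPositivity
import Summits.QuantumFields.YangMills.Theorems.FemtoTransferGapRungW1up
import Summits.QuantumFields.YangMills.Theorems.FemtoTransferGapReduction
import Summits.QuantumFields.YangMills.Theorems.LuscherReductionOneSiteLevelsClosed
import Summits.QuantumFields.YangMills.Theorems.LuscherReductionRunningReductionExplicitNoIntruder
import Literature.Analysis.OperatorTheory.YangMillsMatrixModelDiscreteness
import HarnessLib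

/-!
# `TraceDoorGlue` (stmt-QuantumFields-20206) landing — BASICS: level gaps, shells close, the coarse one-site lower law from ONE, TT seams

Route `LuscherReduction` (owner ym-beyond-p1), RED `RunningReduction` (stmt-QuantumFields-19978) split (route rev 11/12) along the TT door of the
registered skeleton «KTR» rev 8 (`pub/ym-beyond/p1-g19-files/Lines-KTR-r8.lean`, sha16 4d4e029b06d8e70b); glue item `TraceDoorGlue`
(stmt-QuantumFields-20206) = `TraceFormula → TwistedTraceScaling → OneSiteTail → DressedRitz → RunningReduction`, landed under `Theorems/` as the
file family `LuscherReductionTraceDoor{Defs,Enclosure,Basics,InvAtoms,KT,InvPrep,OST,Glue}.lean` (namespace `…Theorems.FemtoTransferGap.TraceDoor`),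
skeleton parts re-homed VERBATIM with the four children taken as the ROUTE DECLS (hypotheses), the skeleton's `Prop` currencies
(`CoarseNoIntruder`, `OneSiteLowerCoarse`, `CoarseLevels`, `OneSiteTraceLimit`) spelled out as texts, the door / Ritz basics / `LevelGapSummable` / ONE
taken from the tree (`KTDoorR3.katoTempleDoorR3`, `KTDoorR3.ritzBasicsR3`, `LGS.levelGapSummable_all`, `oneSiteLevels_proof`).

THIS FILE (skeleton PART 3 §3 + PART 5 §4): `levelGap_nonneg/mono/mono'` (`levelGap_zero` is the tree's), `shellsClose` (every multiplet of Lüscher's `𝔥` ends, from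
`tendsto_physLevel_atTop`), `oneSiteLowerCoarse_of_oneSiteLevels` and its UNCONDITIONAL form `oneSiteLowerCoarse` (ONE is closed:
`oneSiteLevels_proof`, stmt-QuantumFields-20007), `ritz_nonneg`, `coarseNoIntruder_of_coarseLevels` (upper half of the coarse two-sided law),
`femtoSteps_mul_sub_le` (`|T·λ_b − s| ≤ λ_b` at `T = femtoSteps s β L`, `B = oneSiteCoupling β L`), and `twistedTraceScaling_iff` (the route decl
`TwistedTraceScaling`, which inlines `traceRatio`/`femtoSteps`, in its `traceRatio` spelling — `Iff.rfl`).

HONEST FRAMING: femto rung R2b1 (`FemtoGapOfRecord`) bookkeeping — the XL content (`TwistedTraceScaling`, `DressedRitz`) is ASSUMED, not proved;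
nothing here bears on infinite volume, the continuum limit or the Clay mass gap.  Sorry-free, no new definitions.
-/

set_option autoImplicit false

noncomputable section

open MeasureTheory Filter Topology Real
open Literature.MathematicalPhysics.QuantumFieldTheory hiding SU2
open Literature.MathematicalPhysics.QuantumLattice
open Literature.Analysis.OperatorTheory.YMMatrixModel
open scoped BigOperators

namespace Summit.QuantumFields.YangMills.Theorems.FemtoTransferGap.TraceDoor

open Summit.QuantumFields.YangMills.Theorems.FemtoTransferGap
open Summit.QuantumFields.YangMills.Theorems.FemtoTransferGap.TT (physTrace)

/-! ## §1 Level gaps, shells, the coarse one-site lower law (skeleton PART 3 §3) -/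

/-- `0 ≤ Δ_k` (`physLevel` is monotone from level `1`). -/
theorem levelGap_nonneg (k : ℕ) : 0 ≤ levelGap k := by
  have h := physLevel_mono (le_refl 1) (Nat.succ_le_succ (Nat.zero_le k))
  unfold levelGap; linarith

/-- `Δ_j ≤ Δ_k` for `j ≤ k`. -/
theorem levelGap_mono {j k : ℕ} (h : j ≤ k) : levelGap j ≤ levelGap k := by
  have h' := physLevel_mono (Nat.succ_le_succ (Nat.zero_le j)) (Nat.succ_le_succ h)
  unfold levelGap; linarith

/-- **Shells close** (PROVED): every multiplet of Lüscher's `𝔥` ends, from `physLevel → ∞` (`tendsto_physLevel_atTop`, AL-discreteness). -/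
theorem shellsClose (k : ℕ) : ∃ k' : ℕ, k ≤ k' ∧ levelGap k' < levelGap (k' + 1) := by
  by_contra h
  push Not at h
  have hmono : ∀ n : ℕ, levelGap (k + n) ≤ levelGap k := by
    intro n
    induction n with
    | zero => simp
    | succ n ih => exact (h (k + n) (Nat.le_add_right k n)).trans ih
  have hbd : ∀ k' : ℕ, k ≤ k' → physLevel (k' + 1) ≤ physLevel (k + 1) := by
    intro k' hk'
    obtain ⟨n, rfl⟩ := Nat.exists_eq_add_of_le hk'
    have h1 := hmono n
    unfold levelGap at h1
    linarith
  obtain ⟨N, hN⟩ := (tendsto_atTop_atTop.1 tendsto_physLevel_atTop) (physLevel (k + 1) + 1)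
  have h1 := hN (max N (k + 1) + 1) (by omega)
  have h2 := hbd (max N (k + 1)) (by omega)
  linarith

/-- **ONE ⇒ the coarse one-site lower law** (PROVED): absorb `Cλ_b²` into `ελ_b` for `B` large, uniformly over `j ≤ K`. -/
theorem oneSiteLowerCoarse_of_oneSiteLevels
    (hONE : Summit.QuantumFields.YangMills.Theses.LuscherReduction.OneSiteLevels) :
    ∀ K : ℕ, ∀ ε : ℝ, 0 < ε → ∃ B0 : ℝ, ∀ B : ℝ, B0 ≤ B → 0 < levelValue su2Rep 1 B 0 ∧
      ∀ j : ℕ, j ≤ K → Real.exp (-((levelGap j + ε) * bareLambda B)) * levelValue su2Rep 1 B 0 ≤ levelValue su2Rep 1 B j := by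
  have single : ∀ j : ℕ, ∀ ε : ℝ, 0 < ε → ∃ B0 : ℝ, ∀ B : ℝ, B0 ≤ B →
      0 < levelValue su2Rep 1 B 0 ∧
        Real.exp (-((levelGap j + ε) * bareLambda B)) * levelValue su2Rep 1 B 0 ≤ levelValue su2Rep 1 B j := by
    intro j ε hε
    obtain ⟨C, B0, hB⟩ := hONE j
    have hC'pos : 0 < max C 1 := lt_of_lt_of_le one_pos (le_max_right _ _)
    have htpos : 0 < ε / max C 1 := div_pos hε hC'pos
    refine ⟨max B0 (max (2 / (ε / max C 1) ^ 3) 1), fun B hBge => ?_⟩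
    have hB0 : B0 ≤ B := (le_max_left _ _).trans hBge
    have hBt : 2 / (ε / max C 1) ^ 3 ≤ B := ((le_max_left _ _).trans (le_max_right _ _)).trans hBge
    have hB1 : 1 ≤ B := ((le_max_right _ _).trans (le_max_right _ _)).trans hBge
    have hBpos : 0 < B := one_pos.trans_le hB1
    obtain ⟨hpos, _, hlow⟩ := hB B hB0
    refine ⟨hpos, ?_⟩
    have hlam : bareLambda B ≤ ε / max C 1 := bareLambda_le_of_le htpos hBt
    have hlam0 : 0 < bareLambda B := bareLambda_pos' hBpos
    have hCl : C * bareLambda B ^ 2 ≤ ε * bareLambda B := by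
      have h1 : C * bareLambda B ^ 2 ≤ max C 1 * bareLambda B ^ 2 :=
        mul_le_mul_of_nonneg_right (le_max_left _ _) (sq_nonneg _)
      have h2 : max C 1 * bareLambda B ≤ ε := by
        have h3 := mul_le_mul_of_nonneg_left hlam hC'pos.le
        have e : max C 1 * (ε / max C 1) = ε := by field_simp
        linarith
      have h3 : max C 1 * bareLambda B ^ 2 ≤ ε * bareLambda B := by
        have h4 := mul_le_mul_of_nonneg_right h2 hlam0.le
        rw [sq, ← mul_assoc]; exact h4
      linarith
    calc Real.exp (-((levelGap j + ε) * bareLambda B)) * levelValue su2Rep 1 B 0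
        ≤ Real.exp (-(levelGap j * bareLambda B + C * bareLambda B ^ 2)) * levelValue su2Rep 1 B 0 := by
          apply mul_le_mul_of_nonneg_right _ hpos.le
          apply Real.exp_le_exp.mpr
          linarith only [hCl]
      _ ≤ levelValue su2Rep 1 B j := hlow
  intro K ε hε
  induction K with
  | zero =>
    obtain ⟨B0, hB0⟩ := single 0 ε hε
    refine ⟨B0, fun B hB => ⟨(hB0 B hB).1, fun j hj => ?_⟩⟩
    have hj0 : j = 0 := Nat.le_zero.mp hj
    subst hj0
    exact (hB0 B hB).2
  | succ K ih =>
    obtain ⟨B0, hB0⟩ := ih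
    obtain ⟨B1, hB1⟩ := single (K + 1) ε hε
    refine ⟨max B0 B1, fun B hB => ⟨(hB0 B ((le_max_left _ _).trans hB)).1, fun j hj => ?_⟩⟩
    rcases Nat.lt_or_ge j (K + 1) with hlt | hge
    · exact (hB0 B ((le_max_left _ _).trans hB)).2 j (Nat.lt_succ_iff.mp hlt)
    · have hjK : j = K + 1 := le_antisymm hj hge
      subst hjK
      exact (hB1 B ((le_max_right _ _).trans hB)).2

/-- ★ The coarse one-site lower law UNCONDITIONALLY — the route's crux ONE is closed (`oneSiteLevels_proof`, stmt-QuantumFields-20007). -/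
theorem oneSiteLowerCoarse :
    ∀ K : ℕ, ∀ ε : ℝ, 0 < ε → ∃ B0 : ℝ, ∀ B : ℝ, B0 ≤ B → 0 < levelValue su2Rep 1 B 0 ∧
      ∀ j : ℕ, j ≤ K → Real.exp (-((levelGap j + ε) * bareLambda B)) * levelValue su2Rep 1 B 0 ≤ levelValue su2Rep 1 B j :=
  oneSiteLowerCoarse_of_oneSiteLevels Summit.QuantumFields.YangMills.Theorems.FemtoTransferGap.oneSiteLevels_proof

-- `levelGap_zero : levelGap 0 = 0` is the tree's `FemtoTransferGap.levelGap_zero` (`…RunningReductionExplicitNoIntruder.lean`).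

/-- `0 ≤ m_j = ⟨ψ,K_βψ⟩` for a physical trial function and `β ≥ 1` (tree `qform_su2Rep_self_nonneg`): the nonnegativity half of the
rev-2 `RitzBasics` is a theorem, not a stub. -/
theorem ritz_nonneg {L : ℕ} [NeZero L] {β : ℝ} (hβ : 1 ≤ β) {ψ : GaugeConfig 3 L SU2 → ℝ} (hψ : IsPhys ψ) :
    0 ≤ qform su2Rep β ψ ψ :=
  qform_su2Rep_self_nonneg (zero_le_one.trans hβ) hψ

/-- `Δ` is monotone (bundled form). -/
theorem levelGap_mono' : Monotone levelGap := fun j k h => by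
  have h' := physLevel_mono (Nat.succ_le_succ (Nat.zero_le j)) (Nat.succ_le_succ h)
  unfold levelGap; linarith

/-! ## §2 TT seams (skeleton PART 5 §4) and the `traceRatio` spelling of the route decl `TwistedTraceScaling` -/

/-- **`CoarseLevels ⟹ KT.CoarseNoIntruder`** (the upper half at `η = Δ_k − d`). -/
theorem coarseNoIntruder_of_coarseLevels (h : (∀ k : ℕ, ∀ η : ℝ, 0 < η → ∃ lam0 : ℝ, 0 < lam0 ∧ ∀ lam : ℝ, 0 < lam → lam ≤ lam0 →
      ∃ L0 : ℕ, ∀ (L : ℕ) [NeZero L], L0 ≤ L → ∀ β : ℝ, InFemtoWindow lam β L →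
        Real.exp (-((levelGap k + η) * luscherLambda β L) / L) * levelValue su2Rep L β 0 ≤ levelValue su2Rep L β k ∧
          levelValue su2Rep L β k ≤ Real.exp (-((levelGap k - η) * luscherLambda β L) / L) * levelValue su2Rep L β 0)) :
    (∀ k : ℕ, ∀ d : ℝ, d < levelGap k → ∃ lam0 : ℝ, 0 < lam0 ∧ ∀ lam : ℝ, 0 < lam → lam ≤ lam0 →
      ∃ L0 : ℕ, ∀ (L : ℕ) [NeZero L], L0 ≤ L → ∀ β : ℝ, InFemtoWindow lam β L →
        levelValue su2Rep L β k ≤ Real.exp (-(d * luscherLambda β L) / L) * levelValue su2Rep L β 0) := by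
  intro k d hd
  obtain ⟨lam0, hlam0, H⟩ := h k (levelGap k - d) (sub_pos.mpr hd)
  refine ⟨lam0, hlam0, fun lam hlam hle => ?_⟩
  obtain ⟨L0, HL⟩ := H lam hlam hle
  refine ⟨L0, fun L _ hL β hW => ?_⟩
  have h2 := (HL L hL β hW).2
  have e : levelGap k - (levelGap k - d) = d := by ring
  rw [e] at h2
  exact h2

/-- In the window the one-site femto unit is `λ_b(B) = λ/L` at `B = oneSiteCoupling β L` (tree `bareLambda_oneSiteCoupling`), so `femtoSteps` serves
both lattices: `|T·λ_b − s| ≤ λ_b` at `T = femtoSteps s β L` — the hypothesis shape of `OneSiteTraceLimit`. -/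
theorem femtoSteps_mul_sub_le {s lam β : ℝ} {L : ℕ} [NeZero L] (hs : 0 ≤ s) (hlam : 0 < lam) (hW : InFemtoWindow lam β L) :
    |(femtoSteps s β L : ℝ) * bareLambda (oneSiteCoupling β L) - s| ≤ bareLambda (oneSiteCoupling β L) := by
  have hl : 0 < luscherLambda β L := luscherLambda_pos_of_window hlam hW
  have hL0 : (0 : ℝ) < (L : ℝ) := by exact_mod_cast Nat.pos_of_ne_zero (NeZero.ne L)
  rw [bareLambda_oneSiteCoupling hl]
  have hu : 0 < luscherLambda β L / L := div_pos hl hL0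
  have hx : 0 ≤ s * L / luscherLambda β L := by positivity
  have hc1 : s * L / luscherLambda β L ≤ (femtoSteps s β L : ℝ) := Nat.le_ceil _
  have hc2 : (femtoSteps s β L : ℝ) < s * L / luscherLambda β L + 1 := Nat.ceil_lt_add_one hx
  have e1 : s * L / luscherLambda β L * (luscherLambda β L / L) = s := by
    field_simp
  rw [abs_le]
  constructor
  · have : s ≤ (femtoSteps s β L : ℝ) * (luscherLambda β L / L) := by
      calc s = s * L / luscherLambda β L * (luscherLambda β L / L) := e1.symm
        _ ≤ (femtoSteps s β L : ℝ) * (luscherLambda β L / L) := mul_le_mul_of_nonneg_right hc1 hu.le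
    linarith
  · have : (femtoSteps s β L : ℝ) * (luscherLambda β L / L) ≤ (s * L / luscherLambda β L + 1) * (luscherLambda β L / L) :=
      mul_le_mul_of_nonneg_right hc2.le hu.le
    have e2 : (s * L / luscherLambda β L + 1) * (luscherLambda β L / L) = s + luscherLambda β L / L := by
      rw [add_mul, e1, one_mul]
    linarith

/-- The route decl `TwistedTraceScaling` inlines `traceRatio` and `femtoSteps`; this is its `traceRatio` spelling (definitional). -/
theorem twistedTraceScaling_iff :
    Summit.QuantumFields.YangMills.Theses.LuscherReduction.TwistedTraceScaling ↔
      (∀ s : ℝ, 0 < s → ∀ ε : ℝ, 0 < ε → ∃ lam0 : ℝ, 0 < lam0 ∧ ∀ lam : ℝ, 0 < lam → lam ≤ lam0 →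
        ∃ L0 : ℕ, ∀ (L : ℕ) [NeZero L], L0 ≤ L → ∀ β : ℝ, InFemtoWindow lam β L →
          |traceRatio L β (femtoSteps s β L) - traceRatio 1 (oneSiteCoupling β L) (femtoSteps s β L)| ≤ ε) :=
  Iff.rfl

end Summit.QuantumFields.YangMills.Theorems.FemtoTransferGap.TraceDoor

end
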